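import Mathlib.MeasureTheory.Integral.IntervalIntegral.Basic
import HarnessLib

/-!
# Crux `ClampedCurrentsDock` (stmt-AtomisticToContinuum-14680), line `IdeatorTwoSketch`:
# S7b2 — the multi-window ledger summation (generic real analysis)

Helper file (`--supports stmt-AtomisticToContinuum-14680`) for the registered skeleton
`Cruxes/ClampedCurrentsDock/Lines/IdeatorTwoSketch.lean` (stub `stub_ledgerSummation : LedgerSummation`, the generic
summation step S7b2 between the per-channel per-window entropy bounds S7b1 and the Gronwall end S7c of the window
ledger S7).

Mathematics. `H ≥ 0` is bounded on `[0, t]`; for each `t' ∈ [0, t]` there are `m` channels, channel `c` carrying a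
finite set `W c` of windows `p = (s, h)` (the interval `[s, s + h] ⊆ [0, t']`, `h > 0`), pairwise non-overlapping
within the channel, with `H t' ≤ C + Σ_c Σ_{p ∈ W c} h · (A · H s + E)`. Then
`H t' ≤ C + m·t·E + m·A·∫₀^{t'} S`, `S r := sup (H '' [0, r])` the running supremum: `S` is monotone and
nonnegative on `[0, t]` (hence integrable), `h · H s ≤ h · S s ≤ ∫_s^{s+h} S`, and the windows of one channel are
pairwise disjoint sub-intervals of `(0, t']`, so per channel `Σ h ≤ t'` and `Σ h · H s ≤ ∫₀^{t'} S`
(`MeasureTheory.integral_biUnion_finset`, `MeasureTheory.setIntegral_mono_set`); summing over the `m` channels gives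
the claim.

No new objects; the only `def` is the registered stub signature `LedgerSummation` (verbatim from the skeleton).
-/

noncomputable section

namespace Summit.AtomisticToContinuum.HydrodynamicLimit.Theorems.ClampedCurrentsDockSummation

open scoped BigOperators
open MeasureTheory Filter Set Topology

/-- **S7b2 — the multi-window ledger summation** (registered stub signature `stub_ledgerSummation` of line
`IdeatorTwoSketch`, crux `ClampedCurrentsDock`; generic real analysis). For `H ≥ 0` bounded by `B` on `[0, t]`,
`A, E ≥ 0`: if for every `t' ∈ [0, t]` there are `m` channels of finitely many windows `p = (s, h)` with
`0 ≤ s`, `0 < h`, `s + h ≤ t'`, pairwise non-overlapping within each channel, such that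
`H t' ≤ C + Σ_c Σ_{p ∈ W c} h · (A · H s + E)`, then
`H t' ≤ C + m · t · E + m · A · ∫₀^{t'} sup (H '' [0, r]) dr` for every `t' ∈ [0, t]`
(left Riemann sums of the running supremum over non-overlapping windows are dominated by its integral).
Route-internal stub signature, not a cited fact. -/
def LedgerSummation : Prop :=
  ∀ (H : ℝ → ℝ) (t C A E B : ℝ) (m : ℕ), 0 ≤ t → 0 ≤ A → 0 ≤ E →
    (∀ s ∈ Set.Icc 0 t, 0 ≤ H s) → (∀ s ∈ Set.Icc 0 t, H s ≤ B) →
    (∀ t' ∈ Set.Icc 0 t, ∃ W : Fin m → Finset (ℝ × ℝ),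
      (∀ c, ∀ p ∈ W c, 0 ≤ p.1 ∧ 0 < p.2 ∧ p.1 + p.2 ≤ t') ∧
      (∀ c, (↑(W c) : Set (ℝ × ℝ)).Pairwise (fun p q => p.1 + p.2 ≤ q.1 ∨ q.1 + q.2 ≤ p.1)) ∧
      H t' ≤ C + ∑ c, ∑ p ∈ W c, p.2 * (A * H p.1 + E)) →
    ∀ t' ∈ Set.Icc 0 t, H t' ≤ C + m * t * E + m * A * ∫ r in (0 : ℝ)..t', sSup (H '' Set.Icc 0 r)

/-- **One channel.** For a finite family of windows `p = (s, h)` with `0 ≤ s`, `0 < h`, `s + h ≤ t'`, pairwise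
non-overlapping, and a function `g` integrable and a.e. nonnegative on `(0, t']`: the sum over the windows of the
integrals of `g` over `(s, s + h]` is at most `∫_{(0, t']} g` (the windows are pairwise disjoint measurable subsets of
`(0, t']`). [folklore] -/
theorem sum_setIntegral_windows_le {W : Finset (ℝ × ℝ)} {t' : ℝ} {g : ℝ → ℝ}
    (hW1 : ∀ p ∈ W, 0 ≤ p.1 ∧ 0 < p.2 ∧ p.1 + p.2 ≤ t')
    (hW2 : (↑W : Set (ℝ × ℝ)).Pairwise (fun p q => p.1 + p.2 ≤ q.1 ∨ q.1 + q.2 ≤ p.1))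
    (hg : IntegrableOn g (Ioc 0 t')) (hgnn : 0 ≤ᵐ[volume.restrict (Ioc 0 t')] g) :
    ∑ p ∈ W, ∫ r in Ioc p.1 (p.1 + p.2), g r ≤ ∫ r in Ioc 0 t', g r := by
  have hsub : ∀ p ∈ W, Ioc p.1 (p.1 + p.2) ⊆ Ioc 0 t' := fun p hp =>
    Ioc_subset_Ioc (hW1 p hp).1 (hW1 p hp).2.2
  have hdisj : (↑W : Set (ℝ × ℝ)).Pairwise
      (Function.onFun Disjoint fun p : ℝ × ℝ => Ioc p.1 (p.1 + p.2)) := by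
    refine hW2.imp fun p q hpq => ?_
    change Disjoint (Ioc p.1 (p.1 + p.2)) (Ioc q.1 (q.1 + q.2))
    rcases hpq with h | h
    · exact Ioc_disjoint_Ioc_of_le h
    · exact (Ioc_disjoint_Ioc_of_le h).symm
  rw [← integral_biUnion_finset W (fun p _ => measurableSet_Ioc) hdisj fun p hp => hg.mono_set (hsub p hp)]
  exact setIntegral_mono_set hg hgnn (Filter.Eventually.of_forall (Set.iUnion₂_subset hsub))

/-- **One channel, lengths.** The total length of pairwise non-overlapping windows inside `[0, t']` is at most `t'`.
[folklore] -/
theorem sum_lengths_windows_le {W : Finset (ℝ × ℝ)} {t' : ℝ} (ht' : 0 ≤ t')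
    (hW1 : ∀ p ∈ W, 0 ≤ p.1 ∧ 0 < p.2 ∧ p.1 + p.2 ≤ t')
    (hW2 : (↑W : Set (ℝ × ℝ)).Pairwise (fun p q => p.1 + p.2 ≤ q.1 ∨ q.1 + q.2 ≤ p.1)) :
    ∑ p ∈ W, p.2 ≤ t' := by
  have hone : ∀ a b : ℝ, a ≤ b → ∫ _ in Ioc a b, (1 : ℝ) = b - a := by
    intro a b hab
    rw [setIntegral_const, Real.volume_real_Ioc_of_le hab, smul_eq_mul, mul_one]
  have hint : IntegrableOn (fun _ : ℝ => (1 : ℝ)) (Ioc 0 t') volume :=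
    integrableOn_const (by rw [Real.volume_Ioc]; exact ENNReal.ofReal_ne_top)
  have hnn : (0 : ℝ → ℝ) ≤ᵐ[volume.restrict (Ioc (0 : ℝ) t')] fun _ => (1 : ℝ) :=
    Filter.Eventually.of_forall fun _ => zero_le_one
  have h := sum_setIntegral_windows_le hW1 hW2 hint hnn
  have hlhs : ∑ p ∈ W, ∫ _ in Ioc p.1 (p.1 + p.2), (1 : ℝ) = ∑ p ∈ W, p.2 := by
    refine Finset.sum_congr rfl fun p hp => ?_
    rw [hone p.1 (p.1 + p.2) (by linarith [(hW1 p hp).2.1]), add_sub_cancel_left]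
  rw [hlhs, hone 0 t' ht', sub_zero] at h
  exact h

/-- **STUB S7b2 `stub_ledgerSummation` of line `IdeatorTwoSketch` (crux `ClampedCurrentsDock`, stmt-14680): the
multi-window ledger summation.** The running supremum `S r = sup (H '' [0, r])` is monotone, nonnegative and bounded
on `[0, t]`, hence integrable; per window `h · H s ≤ h · S s ≤ ∫_{(s, s+h]} S`; per channel the windows are disjoint
sub-intervals of `(0, t']` (`sum_setIntegral_windows_le`, `sum_lengths_windows_le`); sum over the `m` channels.
[folklore] -/
theorem stub_ledgerSummation : LedgerSummation := by
  intro H t C A E B m ht hA hE hH0 hHB hyp t' ht'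
  obtain ⟨W, hW1, hW2, hW3⟩ := hyp t' ht'
  -- the running supremum and its bookkeeping on `[0, t]`
  set S : ℝ → ℝ := fun r => sSup (H '' Icc 0 r) with hS
  have hbdd : ∀ r ∈ Icc 0 t, BddAbove (H '' Icc 0 r) := by
    intro r hr
    refine ⟨B, ?_⟩
    rintro y ⟨s, hs, rfl⟩
    exact hHB s ⟨hs.1, hs.2.trans hr.2⟩
  have hne : ∀ r ∈ Icc 0 t, (H '' Icc 0 r).Nonempty := fun r hr =>
    ⟨H 0, 0, ⟨le_rfl, hr.1⟩, rfl⟩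
  have hHS : ∀ r ∈ Icc 0 t, H r ≤ S r := fun r hr =>
    le_csSup (hbdd r hr) ⟨r, ⟨hr.1, le_rfl⟩, rfl⟩
  have hSnn : ∀ r ∈ Icc 0 t, 0 ≤ S r := fun r hr =>
    (hH0 0 ⟨le_rfl, ht⟩).trans (le_csSup (hbdd r hr) ⟨0, ⟨le_rfl, hr.1⟩, rfl⟩)
  have hmono : MonotoneOn S (Icc 0 t) := by
    intro r₁ hr₁ r₂ hr₂ h12
    exact csSup_le_csSup (hbdd r₂ hr₂) (hne r₁ hr₁) (image_mono (Icc_subset_Icc le_rfl h12))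
  -- integrability and a.e. nonnegativity of the envelope on `(0, t']`
  have hIcc : Icc 0 t' ⊆ Icc 0 t := Icc_subset_Icc le_rfl ht'.2
  have hint : IntervalIntegrable S volume 0 t' := by
    refine (hmono.mono ?_).intervalIntegrable
    rw [uIcc_of_le ht'.1]
    exact hIcc
  have hSint : IntegrableOn S (Ioc 0 t') volume := hint.1
  have hSnn' : (0 : ℝ → ℝ) ≤ᵐ[volume.restrict (Ioc (0 : ℝ) t')] S :=
    ae_restrict_of_forall_mem (measurableSet_Ioc : MeasurableSet (Ioc (0 : ℝ) t')) fun x hx =>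
      hSnn x ⟨hx.1.le, hx.2.trans ht'.2⟩
  -- per window: `h · H s ≤ ∫_{(s, s+h]} S`
  have hwin : ∀ c, ∀ p ∈ W c, p.2 * H p.1 ≤ ∫ r in Ioc p.1 (p.1 + p.2), S r := by
    intro c p hp
    obtain ⟨hp1, hp2, hp3⟩ := hW1 c p hp
    have hp1t : p.1 ∈ Icc 0 t := ⟨hp1, by linarith [ht'.2]⟩
    have hsub : Ioc p.1 (p.1 + p.2) ⊆ Ioc 0 t' := Ioc_subset_Ioc hp1 hp3
    have hconst : ∫ _ in Ioc p.1 (p.1 + p.2), S p.1 = p.2 * S p.1 := by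
      rw [setIntegral_const, Real.volume_real_Ioc_of_le (by linarith), smul_eq_mul, add_sub_cancel_left]
    calc p.2 * H p.1 ≤ p.2 * S p.1 := mul_le_mul_of_nonneg_left (hHS p.1 hp1t) hp2.le
      _ = ∫ _ in Ioc p.1 (p.1 + p.2), S p.1 := hconst.symm
      _ ≤ ∫ r in Ioc p.1 (p.1 + p.2), S r := by
        refine setIntegral_mono_on
          (integrableOn_const (by rw [Real.volume_Ioc]; exact ENNReal.ofReal_ne_top))
          (hSint.mono_set hsub) measurableSet_Ioc fun r hr => ?_
        exact hmono hp1t ⟨hp1.trans hr.1.le, hr.2.trans (hp3.trans ht'.2)⟩ hr.1.le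
  -- per channel
  have hchanH : ∀ c, ∑ p ∈ W c, p.2 * H p.1 ≤ ∫ r in Ioc 0 t', S r := fun c =>
    (Finset.sum_le_sum (hwin c)).trans (sum_setIntegral_windows_le (hW1 c) (hW2 c) hSint hSnn')
  have hchanL : ∀ c, ∑ p ∈ W c, p.2 ≤ t := fun c =>
    (sum_lengths_windows_le ht'.1 (hW1 c) (hW2 c)).trans ht'.2
  -- sum over the channels
  have hsumH : ∑ c, ∑ p ∈ W c, p.2 * H p.1 ≤ m * ∫ r in Ioc 0 t', S r := by
    calc ∑ c, ∑ p ∈ W c, p.2 * H p.1 ≤ ∑ _c : Fin m, ∫ r in Ioc 0 t', S r := Finset.sum_le_sum fun c _ => hchanH c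
      _ = m * ∫ r in Ioc 0 t', S r := by
        rw [Finset.sum_const, Finset.card_univ, Fintype.card_fin, nsmul_eq_mul]
  have hsumL : ∑ c, ∑ p ∈ W c, p.2 ≤ m * t := by
    calc ∑ c, ∑ p ∈ W c, p.2 ≤ ∑ _c : Fin m, t := Finset.sum_le_sum fun c _ => hchanL c
      _ = m * t := by
        rw [Finset.sum_const, Finset.card_univ, Fintype.card_fin, nsmul_eq_mul]
  have hsplit : ∑ c, ∑ p ∈ W c, p.2 * (A * H p.1 + E) =
      A * ∑ c, ∑ p ∈ W c, p.2 * H p.1 + E * ∑ c, ∑ p ∈ W c, p.2 := by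
    rw [Finset.mul_sum, Finset.mul_sum, ← Finset.sum_add_distrib]
    refine Finset.sum_congr rfl fun c _ => ?_
    rw [Finset.mul_sum, Finset.mul_sum, ← Finset.sum_add_distrib]
    refine Finset.sum_congr rfl fun p _ => ?_
    ring
  rw [intervalIntegral.integral_of_le ht'.1]
  calc H t' ≤ C + ∑ c, ∑ p ∈ W c, p.2 * (A * H p.1 + E) := hW3
    _ = C + (A * ∑ c, ∑ p ∈ W c, p.2 * H p.1 + E * ∑ c, ∑ p ∈ W c, p.2) := by rw [hsplit]
    _ ≤ C + (A * (m * ∫ r in Ioc 0 t', S r) + E * (m * t)) :=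
      add_le_add le_rfl (add_le_add (mul_le_mul_of_nonneg_left hsumH hA) (mul_le_mul_of_nonneg_left hsumL hE))
    _ = C + m * t * E + m * A * ∫ r in Ioc 0 t', S r := by ring

end Summit.AtomisticToContinuum.HydrodynamicLimit.Theorems.ClampedCurrentsDockSummation

end
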